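import Summits.AtomisticToContinuum.BoseEinsteinCondensation.Theorems.BoxLatticeFSumKernels
import Summits.AtomisticToContinuum.BoseEinsteinCondensation.Theorems.SoloInformedGroundStateDoor
import Summits.AtomisticToContinuum.BoseEinsteinCondensation.Theorems.SoloBlindConditionalBEC
import Summits.AtomisticToContinuum.BoseEinsteinCondensation.Theorems.SoloBlindMutualInformation
import Summits.AtomisticToContinuum.BoseEinsteinCondensation.Theorems.SoloBlindBhattacharyya
import Summits.AtomisticToContinuum.BoseEinsteinCondensation.Theorems.SoloBlindTrialStateCriterion
import Literature.MathematicalPhysics.QuantumManyBody.GroundState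
import Literature.MathematicalPhysics.QuantumManyBody.BoseGasCatStates
import Mathlib.MeasureTheory.Constructions.Pi
import Mathlib.MeasureTheory.Integral.MeanInequalities
import HarnessLib


-- PART A (lines 1–351 of lens-6 g34 `land/BoxLabelAffinity.lean`, sha256 f8c3a3ccf8118774…); PART B = `BoxLabelAffinityB`. Split for the 400-line rule by
-- prover hand 1, gen 11 (decomp-a2c LOW lane); declarations byte-identical (one gate-forced docstring added on `flatAffinity_eq`).

/-!
# «LabelAffinity» — a CONDITIONAL-LAW (two-scale affinity) carving of `BoseEinsteinCondensation`
# (decomp-a2c · lens-6 «barrier-complement carving» · g33; conjunct `_root_.BoseEinsteinCondensation`)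

Statement decomposed: the conjunct itself, through the tree's GROUND-STATE DOOR
(`SoloInformed.hasGroundStateBEC_of_groundState_maxOccupation`: eventual nondegeneracy of the Dirichlet
ground states + `λ_max(γ_{Ψ₀}) ≥ cN` for the nonnegative ground state `Ψ₀ = groundState v N L`).  g30–g32
carved the box line's residual along the ENERGY axis (horizon), the COHERENCE axis (door COH ∧ LIP ∧ WIT)
and the SECOND-MOMENT axis (mode purity).  This node carves along a fourth axis, different BY
CONSTRUCTION: the CONDITIONAL ONE-BODY LAW of the `|Ψ₀|²` point process at TWO SCALES.

New quantity.  Tile `Λ_L ⊇ [0,L)³ = ⊔_B Q_B` into the `K³` blocks `Q_B = subCell (L/K) B` of the GP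
window (`L/K ∈ [A/√ρ, 2A/√ρ]`, tree `InWindow`).  For a nonnegative amplitude `Φ` write `P̂(Y) = ∫Φ(x,Y)²dx`
(law of the other `N-1` particles), `q_B(Y) = ∫_{Q_B} Φ(x,Y)² dx` (so `π_B(Y) = q_B/P̂` is the CONDITIONAL
probability that particle 1 lies in block `B` given the others at `Y`) and `m_B(Y) = ℓ^{-3/2}∫_{Q_B}Φ(x,Y)dx`
(amplitude of the block-flat mode `u_B`).  The **block-label affinity**
`labelAffinity L K Φ = ∫ P̂(Y)^{1/2} Σ_B K^{-3/2} q_B(Y)^{1/2} dY = E_{Y∼P̂} Σ_B √(π_B(Y) · K⁻³)`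
is the environment-averaged HELLINGER AFFINITY between the conditional block-label law `π(·|Y)` and the
UNIFORM law on the `K³` blocks; the **block depletion**
`blockDepletion L K Φ = ∫ Σ_B (q_B − m_B²) dY = (1/N) Σ_B ⟨n^{Q_B} − n(u_B)⟩_Φ` is the fraction of
particles not in their own block's flat mode (the physical local depletion of Junge's Cor. 6 / LSSY Thm 7.1,
summed over blocks).

KERNEL (proved here, `labelAffinity_le_affinity_add`): for every normalised `Φ ≥ 0`,
`labelAffinity ≤ BC(u_L) + blockDepletion^{1/2}`, where `BC(u_L)` is the Bhattacharyya affinity of `Φ²` to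
its resampling by the FLAT mode `u_L = L^{-3/2}1_Λ` (tree `SoloBlindBhattacharyya`); with the tree sandwich
`N·BC(u_L)² ≤ n(u_L)` (`bhattacharyya_sq_le_occupation_ae`) this gives
`n(u_L) ≥ N (labelAffinity − blockDepletion^{1/2})²` (`mul_sq_le_maxOccupation`).  Proof: `u_L = Σ_B K^{-3/2} u_B`
pointwise (tree `sum_indicator_subCell`), `m_B ≤ q_B^{1/2}` (Cauchy–Schwarz on the block), the elementary
`√q ≤ m + √(q − m²)`, Cauchy–Schwarz over blocks (`Σ_B K⁻³ = 1`) and over `Y` (`∫P̂ = 1`).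

PIECES (`bec_of_labelAffinity : UGS → LOC → LAB → BoseEinsteinCondensation`, `a = 0` by the tree's
`zeroScatteringBEC_holds`):
* UGS = `BoxGroundStateUniqueness` (support · TAG KNOWN · M): eventual nondegeneracy of the Dirichlet ground
  state of the thermodynamic boxes (Reed–Simon IV Thm XIII.47 for finite `v`; hard cores: XIII.48-type on the
  connected low-density hard-sphere configuration space).  It is the door's own hypothesis, not new here.
* LOC = `GroundStateBlockCondensation` (crux · TAG WEAKER · TRUE-type · leaf ATTACKABLE·L): at fixed window
  constant `A`, the block depletion of `Ψ₀` is `≤ s` below a density cap, for every `s > 0` — local BEC in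
  GP boxes of FIXED coupling `ρℓ²a ≤ 4A²a` with `N_B = ρℓ³ → ∞` ([LS2002]/[LSSY2005] Thm 7.1 localised by
  Neumann bracketing at LHY-irrelevant precision `(A²)(ρa³)^{1/2} → 0`; [Junge2026] Cor. 6 for growing `A`).
  WEAKER than the conjunct: a block-wise phase-disordered condensate satisfies LOC and violates BEC.
* LAB = `GroundStateLabelAffinity` (crux · DECLARED RESIDUAL · TAG UNDECIDED-DIAGONAL · leaf IDEA-NEEDED):
  `labelAffinity(Ψ₀) ≥ c > 0` uniformly — the conditional law of WHICH BLOCK holds particle 1, given all other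
  particles, stays Hellinger-comparable to uniform.  A statement about the DIAGONAL law `|Ψ₀|²` ONLY (a
  point-process / insertion-tolerance statement: quantitative NON-RIGIDITY of `|Ψ₀|²` at the block scale);
  STRICTLY WEAKER than flat-mode BEC (`flatAffinity_le_labelAffinity`: `BC(u_L) ≤ labelAffinity`, and
  `n(u_L)/N ≤ BC(u_L)` by the tree sandwich), not implied by nor implying the conjunct on its own
  (intra-block disorder: LAB holds, BEC fails).

Why this is a barrier complement: every catalogued BEC barrier of the summit
(`EnergyAsymptoticsWithoutCondensation`, `KineticGapLengthScales*`, `BogoliubovPerturbationInfrared`,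
`HalfFilling{ReflectionPositivity,GaussianDomination}`, `FeynmanCyclesVersusCondensation`,
`CasimirBoxGeneralizedCondensation`) quantifies over ENERGY / GAP / RP / CYCLE information; LAB consumes none —
it is a property of the Perron–Frobenius measure `|Ψ₀|²`, reached through positivity (the solo-blind Line I),
and the within-block half of Line I's «lemma M» (oscillation of the conditional amplitude, where the located
wall sits: Wang–Harnack needs semi-log-concavity at the gap scale) is REPLACED by the energy-class input LOC.
What remains of lemma M is only the COARSE (block-mass, environment-averaged, Hellinger) comparability.
-/

/-! LAND TWIN (lens-6 g34, 2026-08-31): gen 33's `LabelAffinityCarving.lean` (HOME/decomp-a2c-lens-6/g33/, sha256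
27fbdeffd25c5bdc…) lines 67–762 VERBATIM, except (i) the §T transcript (g33 lines 77–262) is DELETED — its lemmas
are the tree's own `…Theorems.{lintegral_mul_sq_le_lintegral_sq_mul, bhattacharyya_sq_le_modeWeight_mul,
measurable_vecCons, coe_nnnorm_ofReal_of_nonneg, measurePreserving_vecCons, lintegral_eq_lintegral_lintegral_vecCons,
integrable_mul_of_lintegral_sq_ne_top, ae_integrable_mul_vecCons, occupation_ofReal_eq_ae, bhattacharyya_sq_le_occupation_ae}`
(modules `SoloBlind{Bhattacharyya,TrialStateCriterion,MutualInformation,ConditionalBEC}`, built 2026-08-31T13:42Z),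
now imported; (ii) ADDED `groundStateDoor_holds` (DOOR discharged by `…Theorems.SoloInformedGroundStateDoor`) and
`bec_of_labelAffinity₀ : UGS → LOC → LAB → BoseEinsteinCondensation` (no door hypothesis). -/

noncomputable section

open MeasureTheory Filter Set
open scoped ENNReal NNReal BigOperators

namespace Summit.AtomisticToContinuum.BoseEinsteinCondensation.Theorems.BoxLabelAffinity

open Literature.MathematicalPhysics.QuantumManyBody.BoseGas
open Summit.AtomisticToContinuum.BoseEinsteinCondensation.Theorems.BoxLatticeFSum

/-! ### §0  Two `rpow` conveniences — DELETED at landing (gate dedup: `(m²)^{1/2} = m` ≡ `Literature…ennreal_sq_rpow_half`,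
`(m^{1/2})² = m` ≡ `ENNReal.rpow_half_sq`); each user below re-derives them as a local `have` (two `rw`s). -/

/-! ### §1  The abstract kernel: label affinity ≤ mode affinity + √depletion -/

section Abstract

variable {β : Type*} [MeasurableSpace β]

/-- `√q ≤ m + √(q - m²)` whenever `m² ≤ q` (write `q = m² + d` and use `√(a+b) ≤ √a + √b`). [folklore] -/
theorem rpow_half_le_add_rpow_half_tsub {m q : ℝ≥0∞} (h : m ^ 2 ≤ q) :
    q ^ (1 / 2 : ℝ) ≤ m + (q - m ^ 2) ^ (1 / 2 : ℝ) := by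
  have rpow_half_sq : ∀ m : ℝ≥0∞, (m ^ 2) ^ (1 / 2 : ℝ) = m := fun m => by
    rw [← ENNReal.rpow_two, ← ENNReal.rpow_mul]; norm_num
  have hq : m ^ 2 + (q - m ^ 2) = q := add_tsub_cancel_of_le h
  calc q ^ (1 / 2 : ℝ) = (m ^ 2 + (q - m ^ 2)) ^ (1 / 2 : ℝ) := by rw [hq]
    _ ≤ (m ^ 2) ^ (1 / 2 : ℝ) + (q - m ^ 2) ^ (1 / 2 : ℝ) :=
        ENNReal.rpow_add_le_add_rpow _ _ (by norm_num) (by norm_num)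
    _ = m + (q - m ^ 2) ^ (1 / 2 : ℝ) := by rw [rpow_half_sq]

/-- Cauchy–Schwarz over a finite index set: `Σ wᵢ √dᵢ ≤ (Σ wᵢ²)^{1/2} (Σ dᵢ)^{1/2}`. [folklore] -/
theorem sum_mul_rpow_half_le {ι : Type*} (s : Finset ι) (w d : ι → ℝ≥0∞) :
    ∑ i ∈ s, w i * d i ^ (1 / 2 : ℝ) ≤
      (∑ i ∈ s, w i ^ 2) ^ (1 / 2 : ℝ) * (∑ i ∈ s, d i) ^ (1 / 2 : ℝ) := by
  have sq_rpow_half : ∀ m : ℝ≥0∞, (m ^ (1 / 2 : ℝ)) ^ 2 = m := fun m => by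
    rw [← ENNReal.rpow_two, ← ENNReal.rpow_mul]; norm_num
  have h := ENNReal.inner_le_Lp_mul_Lq s w (fun i => d i ^ (1 / 2 : ℝ))
    Real.HolderConjugate.two_two
  refine h.trans (le_of_eq ?_)
  congr 1
  · congr 1
    exact Finset.sum_congr rfl fun i _ => by rw [ENNReal.rpow_two]
  · congr 1
    exact Finset.sum_congr rfl fun i _ => by rw [ENNReal.rpow_two, sq_rpow_half]

/-- **Abstract label-affinity inequality.**  For weights `wᵢ`, a density factor `g ≥ 0` and
functions `mᵢ² ≤ qᵢ` on `β`:
`∫ g Σᵢ wᵢ √qᵢ ≤ ∫ g Σᵢ wᵢ mᵢ + (Σᵢ wᵢ²)^{1/2} (∫ g²)^{1/2} (∫ Σᵢ (qᵢ - mᵢ²))^{1/2}`.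
(Pointwise `√qᵢ ≤ mᵢ + √(qᵢ - mᵢ²)`, Cauchy–Schwarz over `i`, then over `β`.) [folklore] -/
theorem label_affinity_core {ι : Type*} (s : Finset ι) (ν : Measure β) (w : ι → ℝ≥0∞)
    {g : β → ℝ≥0∞} {m q : ι → β → ℝ≥0∞} (hg : Measurable g)
    (hm : ∀ i, Measurable (m i)) (hq : ∀ i, Measurable (q i))
    (hmq : ∀ i b, m i b ^ 2 ≤ q i b) :
    ∫⁻ b, g b * ∑ i ∈ s, w i * q i b ^ (1 / 2 : ℝ) ∂ν ≤
      ∫⁻ b, g b * ∑ i ∈ s, w i * m i b ∂ν +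
        (∑ i ∈ s, w i ^ 2) ^ (1 / 2 : ℝ) *
          ((∫⁻ b, g b ^ 2 ∂ν) ^ (1 / 2 : ℝ) *
            (∫⁻ b, ∑ i ∈ s, (q i b - m i b ^ 2) ∂ν) ^ (1 / 2 : ℝ)) := by
  have sq_rpow_half : ∀ m : ℝ≥0∞, (m ^ (1 / 2 : ℝ)) ^ 2 = m := fun m => by
    rw [← ENNReal.rpow_two, ← ENNReal.rpow_mul]; norm_num
  set W : ℝ≥0∞ := (∑ i ∈ s, w i ^ 2) ^ (1 / 2 : ℝ) with hW
  -- pointwise bound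
  have hpt : ∀ b, g b * ∑ i ∈ s, w i * q i b ^ (1 / 2 : ℝ) ≤
      g b * ∑ i ∈ s, w i * m i b +
        W * (g b * (∑ i ∈ s, (q i b - m i b ^ 2)) ^ (1 / 2 : ℝ)) := by
    intro b
    calc g b * ∑ i ∈ s, w i * q i b ^ (1 / 2 : ℝ)
        ≤ g b * ∑ i ∈ s, (w i * m i b + w i * (q i b - m i b ^ 2) ^ (1 / 2 : ℝ)) := by
          gcongr with i hi
          rw [← mul_add]
          gcongr
          exact rpow_half_le_add_rpow_half_tsub (hmq i b)
      _ = g b * ∑ i ∈ s, w i * m i b +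
            g b * ∑ i ∈ s, w i * (q i b - m i b ^ 2) ^ (1 / 2 : ℝ) := by
          rw [Finset.sum_add_distrib, mul_add]
      _ ≤ g b * ∑ i ∈ s, w i * m i b +
            g b * (W * (∑ i ∈ s, (q i b - m i b ^ 2)) ^ (1 / 2 : ℝ)) := by
          gcongr
          exact sum_mul_rpow_half_le s w _
      _ = g b * ∑ i ∈ s, w i * m i b +
            W * (g b * (∑ i ∈ s, (q i b - m i b ^ 2)) ^ (1 / 2 : ℝ)) := by ring
  -- integrate, then Cauchy–Schwarz in `b`
  have hd : Measurable fun b => (∑ i ∈ s, (q i b - m i b ^ 2)) ^ (1 / 2 : ℝ) :=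
    (Finset.measurable_sum s fun i _ => (hq i).sub ((hm i).pow_const 2)).pow_const _
  have hgd : Measurable fun b => g b * (∑ i ∈ s, (q i b - m i b ^ 2)) ^ (1 / 2 : ℝ) := hg.mul hd
  calc ∫⁻ b, g b * ∑ i ∈ s, w i * q i b ^ (1 / 2 : ℝ) ∂ν
      ≤ ∫⁻ b, (g b * ∑ i ∈ s, w i * m i b +
          W * (g b * (∑ i ∈ s, (q i b - m i b ^ 2)) ^ (1 / 2 : ℝ))) ∂ν := lintegral_mono hpt
    _ = ∫⁻ b, g b * ∑ i ∈ s, w i * m i b ∂ν +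
          W * ∫⁻ b, g b * (∑ i ∈ s, (q i b - m i b ^ 2)) ^ (1 / 2 : ℝ) ∂ν := by
        rw [lintegral_add_right _ (hgd.const_mul W), lintegral_const_mul W hgd]
    _ ≤ ∫⁻ b, g b * ∑ i ∈ s, w i * m i b ∂ν +
          W * ((∫⁻ b, g b ^ 2 ∂ν) ^ (1 / 2 : ℝ) *
            (∫⁻ b, ∑ i ∈ s, (q i b - m i b ^ 2) ∂ν) ^ (1 / 2 : ℝ)) := by
        gcongr
        have h := ENNReal.lintegral_mul_le_Lp_mul_Lq ν Real.HolderConjugate.two_two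
          hg.aemeasurable hd.aemeasurable
        simp only [Pi.mul_apply, ENNReal.rpow_two, sq_rpow_half] at h
        exact h

end Abstract

/-! ### §2  The physical objects: slices, blocks, label affinity, block depletion -/

variable {n : ℕ}

/-- `P̂(Y) = ∫ Φ(x,Y)² dx`: the (unnormalised) law of the other `N - 1` particles. [folklore] -/
def sliceSq (Φ : Config (n + 1) → ℝ) (Y : Config n) : ℝ≥0∞ :=
  ∫⁻ x, ENNReal.ofReal (Φ (Matrix.vecCons x Y)) ^ 2

/-- `q_B(Y) = ∫_{Q_B} Φ(x,Y)² dx`: joint weight of «particle 1 in block `B`, the others at `Y`»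
(`Q_B = subCell (L/K) B`; `q_B / P̂` is the conditional block probability `π_B(Y)`). [folklore] -/
def blockMass (L : ℝ) (K : ℕ) (Φ : Config (n + 1) → ℝ) (B : SubIdx K) (Y : Config n) : ℝ≥0∞ :=
  ∫⁻ x in subCell (L / (K : ℝ)) B, ENNReal.ofReal (Φ (Matrix.vecCons x Y)) ^ 2

/-- `m_B(Y) = ℓ^{-3/2} ∫_{Q_B} Φ(x,Y) dx`: the amplitude of the block-flat mode `u_B = ℓ^{-3/2}1_{Q_B}`
in the slice `Φ(·,Y)` (`∫ m_B² dY = n(u_B)/N`). [folklore] -/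
def blockAmp (L : ℝ) (K : ℕ) (Φ : Config (n + 1) → ℝ) (B : SubIdx K) (Y : Config n) : ℝ≥0∞ :=
  ENNReal.ofReal ((Real.sqrt ((L / (K : ℝ)) ^ 3))⁻¹) *
    ∫⁻ x in subCell (L / (K : ℝ)) B, ENNReal.ofReal (Φ (Matrix.vecCons x Y))

/-- The uniform block weight `w_K = K^{-3/2} = (|Q_B|/|Λ_L|)^{1/2}`. [folklore] -/
def blockWeight (K : ℕ) : ℝ≥0∞ := ENNReal.ofReal ((Real.sqrt (1 / (K : ℝ))) ^ 3)

/-- **Block-label affinity** `∫ P̂(Y)^{1/2} Σ_B K^{-3/2} q_B(Y)^{1/2} dY = E_{Y∼P̂} Σ_B √(π_B(Y) K⁻³)`: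
the environment-averaged Hellinger affinity of the conditional block-label law of particle 1 to the
uniform law on the `K³` blocks. NEW OBJECT of this node. [folklore] -/
def labelAffinity (L : ℝ) (K : ℕ) (Φ : Config (n + 1) → ℝ) : ℝ≥0∞ :=
  ∫⁻ Y : Config n, sliceSq Φ Y ^ (1 / 2 : ℝ) *
    ∑ B : SubIdx K, blockWeight K * blockMass L K Φ B Y ^ (1 / 2 : ℝ)

/-- **Block depletion** `∫ Σ_B (q_B − m_B²) dY = (1/N) Σ_B ⟨n^{Q_B} − n(u_B)⟩`: the fraction of particles
that are not in the flat mode of their own block (each summand `≥ 0` by Cauchy–Schwarz, so the truncated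
subtraction is exact). [folklore] -/
def blockDepletion (L : ℝ) (K : ℕ) (Φ : Config (n + 1) → ℝ) : ℝ≥0∞ :=
  ∫⁻ Y : Config n, ∑ B : SubIdx K, (blockMass L K Φ B Y - blockAmp L K Φ B Y ^ 2)

/-- The affinity of `Φ²` to its resampling by the flat mode, in the tree's `SoloBlindBhattacharyya`
currency: `BC(u_L) = ∫ (∫ u_L(x) Φ(x,Y) dx) P̂(Y)^{1/2} dY`. [folklore] -/
def flatAffinity (L : ℝ) (Φ : Config (n + 1) → ℝ) : ℝ≥0∞ :=
  ∫⁻ Y : Config n, (∫⁻ x, ENNReal.ofReal (flatReal L x) * ENNReal.ofReal (Φ (Matrix.vecCons x Y))) *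
    sliceSq Φ Y ^ (1 / 2 : ℝ)
  where
  /-- The real flat mode `u_L = L^{-3/2} 1_{[0,L)³}`. [folklore] -/
  flatReal (L : ℝ) (x : Space) : ℝ := (cell L).indicator (fun _ => (Real.sqrt (L ^ 3))⁻¹) x

/-! ### §3  The flat mode as the uniform superposition of block-flat modes -/

/-- The real flat mode `u_L = L^{-3/2} 1_{[0,L)³}`. [folklore] -/
def flatReal (L : ℝ) (x : Space) : ℝ := (cell L).indicator (fun _ => (Real.sqrt (L ^ 3))⁻¹) x

/-- Unfolding `flatAffinity` through the real flat mode `flatReal`. [folklore] -/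
theorem flatAffinity_eq (L : ℝ) (Φ : Config (n + 1) → ℝ) :
    flatAffinity L Φ = ∫⁻ Y : Config n,
      (∫⁻ x, ENNReal.ofReal (flatReal L x) * ENNReal.ofReal (Φ (Matrix.vecCons x Y))) *
        sliceSq Φ Y ^ (1 / 2 : ℝ) := rfl

/-- `u_L ≥ 0`. [folklore] -/
theorem flatReal_nonneg (L : ℝ) : 0 ≤ flatReal L := fun x => by
  show (0 : ℝ) ≤ flatReal L x
  unfold flatReal
  by_cases hx : x ∈ cell L
  · rw [Set.indicator_of_mem hx]; positivity
  · rw [Set.indicator_of_notMem hx]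

/-- `u_L` is measurable. [folklore] -/
theorem measurable_flatReal (L : ℝ) : Measurable (flatReal L) :=
  measurable_const.indicator (measurableSet_cell L)

/-- The complexified real flat mode is the tree's `constantMode L`. [folklore] -/
theorem ofReal_flatReal (L : ℝ) : (fun x => ((flatReal L x : ℝ) : ℂ)) = constantMode L := by
  funext x
  unfold flatReal constantMode
  by_cases hx : x ∈ cell L
  · rw [Set.indicator_of_mem hx, Set.indicator_of_mem hx, Complex.ofReal_inv]
  · rw [Set.indicator_of_notMem hx, Set.indicator_of_notMem hx, Complex.ofReal_zero]

/-- `‖u_L(x)‖ = u_L(x)` as extended reals. [folklore] -/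
theorem enorm_constantMode_eq (L : ℝ) (x : Space) :
    ((‖constantMode L x‖₊ : ℝ≥0) : ℝ≥0∞) = ENNReal.ofReal (flatReal L x) := by
  rw [← ofReal_flatReal, coe_nnnorm_ofReal_of_nonneg (flatReal_nonneg L x)]

/-- `∫ u_L² = 1` (`L > 0`). [folklore] -/
theorem lintegral_flatReal_sq {L : ℝ} (hL : 0 < L) :
    ∫⁻ x, ENNReal.ofReal (flatReal L x) ^ 2 = 1 := by
  rw [← lintegral_constantMode_sq hL]
  exact lintegral_congr fun x => by rw [enorm_constantMode_eq]

/-- **`u_L = Σ_B K^{-3/2} u_B` pointwise** (the blocks tile `[0,L)³`; tree `sum_indicator_subCell`,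
`sqrt_inv_cube_mul`). [folklore] -/
theorem ofReal_flatReal_eq_sum {L : ℝ} {K : ℕ} (hL : 0 < L) (hK : 0 < K) (x : Space) :
    ENNReal.ofReal (flatReal L x) =
      ∑ B : SubIdx K, (subCell (L / (K : ℝ)) B).indicator
        (fun _ => blockWeight K * ENNReal.ofReal ((Real.sqrt ((L / (K : ℝ)) ^ 3))⁻¹)) x := by
  have hKr : (0 : ℝ) < K := by exact_mod_cast hK
  have hℓ : 0 < L / (K : ℝ) := div_pos hL hKr
  rw [sum_indicator_subCell hℓ, mul_div_cancel₀ L hKr.ne']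
  have hc : blockWeight K * ENNReal.ofReal ((Real.sqrt ((L / (K : ℝ)) ^ 3))⁻¹) =
      ENNReal.ofReal ((Real.sqrt (L ^ 3))⁻¹) := by
    rw [blockWeight, ← ENNReal.ofReal_mul (by positivity), sqrt_inv_cube_mul hK hL]
  rw [hc]
  unfold flatReal
  by_cases hx : x ∈ cell L
  · rw [Set.indicator_of_mem hx, Set.indicator_of_mem hx]
  · rw [Set.indicator_of_notMem hx, Set.indicator_of_notMem hx, ENNReal.ofReal_zero]

/-- **The flat pairing splits over blocks**: `∫ u_L Φ(·,Y) = Σ_B K^{-3/2} m_B(Y)`. [folklore] -/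
theorem lintegral_flat_slice {L : ℝ} {K : ℕ} (hL : 0 < L) (hK : 0 < K)
    {Φ : Config (n + 1) → ℝ} (hΦm : Measurable Φ) (Y : Config n) :
    ∫⁻ x, ENNReal.ofReal (flatReal L x) * ENNReal.ofReal (Φ (Matrix.vecCons x Y)) =
      ∑ B : SubIdx K, blockWeight K * blockAmp L K Φ B Y := by
  have hF : Measurable fun x => ENNReal.ofReal (Φ (Matrix.vecCons x Y)) :=
    (hΦm.comp (measurable_vecCons.comp (measurable_id.prodMk measurable_const))).ennreal_ofReal
  set c : ℝ≥0∞ := blockWeight K * ENNReal.ofReal ((Real.sqrt ((L / (K : ℝ)) ^ 3))⁻¹) with hc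
  have hpt : ∀ x, ENNReal.ofReal (flatReal L x) * ENNReal.ofReal (Φ (Matrix.vecCons x Y)) =
      ∑ B : SubIdx K, (subCell (L / (K : ℝ)) B).indicator
        (fun x => c * ENNReal.ofReal (Φ (Matrix.vecCons x Y))) x := by
    intro x
    rw [ofReal_flatReal_eq_sum hL hK, Finset.sum_mul]
    refine Finset.sum_congr rfl fun B _ => ?_
    by_cases hx : x ∈ subCell (L / (K : ℝ)) B
    · rw [Set.indicator_of_mem hx, Set.indicator_of_mem hx]
    · rw [Set.indicator_of_notMem hx, Set.indicator_of_notMem hx, zero_mul]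
  simp_rw [hpt]
  rw [lintegral_finsetSum _ fun B _ => (hF.const_mul c).indicator (measurableSet_subCell _ B)]
  refine Finset.sum_congr rfl fun B _ => ?_
  rw [lintegral_indicator (measurableSet_subCell _ B), lintegral_const_mul c hF, hc, blockAmp,
    mul_assoc]

/-- `∫_{Q_B} ℓ⁻³ dx = 1`: the block-flat mode is normalised on its block. [folklore] -/
theorem setLIntegral_blockConst_sq {ℓ : ℝ} (hℓ : 0 < ℓ) {K : ℕ} (B : SubIdx K) :
    ∫⁻ _ in subCell ℓ B, ENNReal.ofReal ((Real.sqrt (ℓ ^ 3))⁻¹) ^ 2 = 1 := by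
  rw [← lintegral_subMode_sq hℓ B, ← lintegral_indicator (measurableSet_subCell ℓ B)]
  refine lintegral_congr fun x => ?_
  rw [subMode_eq_indicator]
  by_cases hx : x ∈ subCell ℓ B
  · rw [Set.indicator_of_mem hx, Set.indicator_of_mem hx, ← Complex.ofReal_inv,
      coe_nnnorm_ofReal_of_nonneg (by positivity)]
  · rw [Set.indicator_of_notMem hx, Set.indicator_of_notMem hx, nnnorm_zero, ENNReal.coe_zero,
      zero_pow two_ne_zero]

/-- **Cauchy–Schwarz on a block**: `m_B(Y)² ≤ q_B(Y)`. [folklore] -/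
theorem blockAmp_sq_le_blockMass {L : ℝ} {K : ℕ} (hL : 0 < L) (hK : 0 < K)
    {Φ : Config (n + 1) → ℝ} (hΦm : Measurable Φ) (B : SubIdx K) (Y : Config n) :
    blockAmp L K Φ B Y ^ 2 ≤ blockMass L K Φ B Y := by
  have hKr : (0 : ℝ) < K := by exact_mod_cast hK
  have hℓ : 0 < L / (K : ℝ) := div_pos hL hKr
  have hF : Measurable fun x => ENNReal.ofReal (Φ (Matrix.vecCons x Y)) :=
    (hΦm.comp (measurable_vecCons.comp (measurable_id.prodMk measurable_const))).ennreal_ofReal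
  set c : ℝ≥0∞ := ENNReal.ofReal ((Real.sqrt ((L / (K : ℝ)) ^ 3))⁻¹)
  unfold blockAmp blockMass
  rw [← lintegral_const_mul c hF]
  calc (∫⁻ x in subCell (L / (K : ℝ)) B, c * ENNReal.ofReal (Φ (Matrix.vecCons x Y))) ^ 2
      ≤ (∫⁻ _ in subCell (L / (K : ℝ)) B, c ^ 2) *
          ∫⁻ x in subCell (L / (K : ℝ)) B, ENNReal.ofReal (Φ (Matrix.vecCons x Y)) ^ 2 :=
        lintegral_mul_sq_le_lintegral_sq_mul _ aemeasurable_const hF.aemeasurable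
    _ = ∫⁻ x in subCell (L / (K : ℝ)) B, ENNReal.ofReal (Φ (Matrix.vecCons x Y)) ^ 2 := by
        rw [setLIntegral_blockConst_sq hℓ B, one_mul]

/-- `Σ_B w_K² = K³ · K⁻³ = 1`. [folklore] -/
theorem sum_blockWeight_sq {K : ℕ} (hK : 0 < K) : ∑ _B : SubIdx K, blockWeight K ^ 2 = 1 := by
  have hKr : (0 : ℝ) < K := by exact_mod_cast hK
  have h2 : ((Real.sqrt (1 / (K : ℝ))) ^ 3) ^ 2 = ((K : ℝ) ^ 3)⁻¹ := by
    rw [← pow_mul, show 3 * 2 = 2 * 3 by norm_num, pow_mul, Real.sq_sqrt (by positivity), one_div,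
      inv_pow]
  rw [Finset.sum_const, Finset.card_univ, show Fintype.card (SubIdx K) = K ^ 3 by simp, nsmul_eq_mul,
    blockWeight, ← ENNReal.ofReal_pow (by positivity), h2, Nat.cast_pow, ← ENNReal.ofReal_natCast,
    ← ENNReal.ofReal_pow hKr.le, ← ENNReal.ofReal_mul (by positivity),
    mul_inv_cancel₀ (by positivity), ENNReal.ofReal_one]

end Summit.AtomisticToContinuum.BoseEinsteinCondensation.Theorems.BoxLabelAffinity
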